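import Mathlib
import Summits.ValiantsHypothesis.ValiantsHypothesis.Theorems.BarrierLeverPartitionMinorsHitByVPHiddenStatesFullJoinLeaf

/-!
# Route BarrierLever — item `PartitionMinorsHitByVP` (stmt-ValiantsHypothesis-19717), line `hidden_states`:
# THE TRACE CRITERION for one-cube designs (core + free states) — explicit `0/1/2` tables, no genericity

Helper file 1/2 (`--supports stmt-ValiantsHypothesis-19717`; cell valiant-natproofs, rung V4, 𝒟-side door (c), line
`Cruxes/PartitionMinorsHitByVP/Lines/hidden_states.lean` v9; prover seat val-np-p3 gen 17; mandate R26 (ii) of planner p1 g23).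
Definition-free; closes NO item. Part 2 (`…FullJoinCubeCore`) applies the criterion to cube-core designs and to UTD-flat at the first pair.

THE ONE-SIDED NODE. `FullJoin.Stmt.universalThresholdDesign` (p679900; ⇒ item with `b = 8`, ⇒ the registered nodes by
`…FullJoinArrows`, p683550) asks, for each `(h, r)`, for ONE threshold design `J : Fin r → Finset (Fin K)` (`K ≤ h³`) such that
EVERY injective row family `u : Fin r → Finset (Fin h)` has a block-additive table `tx` with
`det[∏_{a ∈ u i}(tx none a + Σ_{q ∈ J k} tx (some q) a)]_{i,k} ≠ 0`.

* `exists_table_of_core_trace` — **THE TRACE CRITERION.** Let the design consist of CORE members (the members inside a set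
  `core` of states, closed under subsets) and FREE members (singletons `{q}`, `q ∉ core`), and let `ι` be injective on `core`.
  If every core member `J k` is realised as a TRACE of the row family on `ι(core)` — some row has `u i ∩ ι(core) = ι(J k)` —
  then a nonsingular table exists. TABLE: base point `𝟙`; core state `q ↦ e_{ι q}` (a core column reads `2^{|u i ∩ ι(J k)|}`); the
  free state of `{q}` ↦ `𝟙_W − 𝟙` for a row set `W = u i_k` (a free column reads `[u i ⊆ W]`). PROOF: on the realising rows the core
  block is `[2^{|J k ∩ J k'|}] = Z·Zᵀ` with `Z` the inclusion matrix of the core (`isUnit_twoPowInter`, `inclusionMatrix_isUnit'`,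
  `card_filter_subset_eq_two_pow`), so the core columns are independent; the inclusion columns `[u i ⊆ u k]` form a basis
  (`inclusionMatrix_isUnit`, p675793) and complete them by Steinitz exchange (`LinearIndepOn.id_insert`, `finrank_span_finset_eq_card`).
* `exists_shatters_of_card_gt` — Mathlib's Sauer–Shelah–Perles lemma (`Finset.card_le_card_shatterer`,
  `Finset.card_shatterer_le_sum_vcDim`) in the form used in part 2: more than `Σ_{i<m} C(h,i)` distinct subsets of `Fin h` shatter
  some `m`-set — and a shattered set is exactly a realised CUBE core.

WHAT THIS IS NOT: a criterion, not a proof of UTD; item 19717 stays OPEN; nothing on crux 14610 or VP ≠ VNP.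
-/

set_option linter.dupNamespace false

namespace Summit.ValiantsHypothesis.ValiantsHypothesis.Theorems.BarrierLever.HiddenStates

open Finset Matrix

noncomputable section

namespace FullJoin

variable {h r K : ℕ}

/-! ## 1. Linear-algebra helpers -/

/-- The square inclusion matrix `[v c ⊆ v c']` of an injective family indexed by any finite type is a unit
(reindexing of `inclusionMatrix_isUnit`). -/
theorem inclusionMatrix_isUnit' {ι : Type*} [Fintype ι] [DecidableEq ι] {n : ℕ} (v : ι → Finset (Fin n))
    (hv : Function.Injective v) :
    IsUnit (Matrix.of fun c c' : ι => if v c ⊆ v c' then (1 : ℂ) else 0) := by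
  classical
  set e := Fintype.equivFin ι with he
  have hu : Function.Injective (fun i : Fin (Fintype.card ι) => v (e.symm i)) :=
    fun i j hij => e.symm.injective (hv hij)
  have h1 := inclusionMatrix_isUnit (fun i : Fin (Fintype.card ι) => v (e.symm i)) hu
  have h2 : (Matrix.of fun c c' : ι => if v c ⊆ v c' then (1 : ℂ) else 0) =
      (Matrix.of fun i k : Fin (Fintype.card ι) => if v (e.symm i) ⊆ v (e.symm k) then (1 : ℂ) else 0).submatrix e e := by
    ext c c'
    simp
  rw [h2, Matrix.isUnit_submatrix_equiv]
  exact h1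

/-! ## 2. The Gram identity `[2^{|J c ∩ J c'|}] = Z·Zᵀ` on a down-closed core, and independence of the core columns -/

/-- Counting: if every subset of `J a` is a member of the (injective) family, the members below `S ⊆ J a` are exactly the
`2^{|S|}` subsets of `S`. -/
theorem card_filter_subset_eq_two_pow {ι : Type*} [Fintype ι] [DecidableEq ι] {n : ℕ} (J : ι → Finset (Fin n))
    (hJ : Function.Injective J) (a : ι) (hdown : ∀ I ⊆ J a, ∃ c, J c = I) (S : Finset (Fin n)) (hS : S ⊆ J a) :
    #(Finset.univ.filter fun c : ι => J c ⊆ S) = 2 ^ #S := by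
  classical
  rw [← Finset.card_powerset, ← Finset.card_image_of_injective (Finset.univ.filter fun c : ι => J c ⊆ S) hJ]
  congr 1
  ext I
  simp only [Finset.mem_image, Finset.mem_filter, Finset.mem_univ, true_and, Finset.mem_powerset]
  constructor
  · rintro ⟨c, hc, rfl⟩; exact hc
  · intro hI
    obtain ⟨c, hc⟩ := hdown I (hI.trans hS)
    exact ⟨c, hc ▸ hI, hc⟩

/-- **Gram identity.** For an injective, down-closed family `J` (every subset of a member is a member) the matrix
`G[a,b] = 2^{|J a ∩ J b|}` is `Z·Zᵀ` with `Z[a,c] = [J c ⊆ J a]`, hence a unit. -/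
theorem isUnit_twoPowInter {ι : Type*} [Fintype ι] [DecidableEq ι] {n : ℕ} (J : ι → Finset (Fin n))
    (hJ : Function.Injective J) (hdown : ∀ a, ∀ I ⊆ J a, ∃ c, J c = I) :
    IsUnit (Matrix.of fun a b : ι => (2 : ℂ) ^ #(J a ∩ J b)) := by
  classical
  set Z : Matrix ι ι ℂ := Matrix.of fun a c => if J c ⊆ J a then (1 : ℂ) else 0 with hZ
  have hZu : IsUnit Z := by
    have := inclusionMatrix_isUnit' J hJ
    -- `Z` is the transpose of the inclusion matrix
    have hT : Z = (Matrix.of fun c c' : ι => if J c ⊆ J c' then (1 : ℂ) else 0)ᵀ := by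
      ext a c; simp [hZ]
    rw [hT, Matrix.isUnit_transpose]
    exact this
  have hG : (Matrix.of fun a b : ι => (2 : ℂ) ^ #(J a ∩ J b)) = Z * Zᵀ := by
    ext a b
    simp only [Matrix.of_apply, Matrix.mul_apply, Matrix.transpose_apply, hZ, mul_ite, mul_one, mul_zero]
    have : (∑ x : ι, if J x ⊆ J b then (if J x ⊆ J a then (1 : ℂ) else 0) else 0) =
        ∑ x : ι, (if J x ⊆ J a ∩ J b then (1 : ℂ) else 0) := by
      refine Finset.sum_congr rfl fun x _ => ?_
      by_cases h1 : J x ⊆ J b <;> by_cases h2 : J x ⊆ J a <;> simp [h1, h2, Finset.subset_inter_iff]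
    rw [this, Finset.sum_boole]
    have hc := card_filter_subset_eq_two_pow J hJ a (hdown a) (J a ∩ J b) Finset.inter_subset_left
    rw [hc]
    push_cast
    ring
  rw [hG]
  exact hZu.mul (Matrix.isUnit_transpose _ |>.mpr hZu)

/-! ## 3. The trace criterion -/

/-- **THE TRACE CRITERION (core + free states).** Let the one-cube design `J : Fin r → Finset (Fin K)` (injective) consist of
CORE members (`J k ⊆ core`, closed under taking subsets) and FREE members (singletons `{q}` with `q ∉ core`), and let
`ι` be injective on the core states. If the row family `u` realises every core member as a TRACE on `ι(core)` — for each
core `J k` some row `u i` has `u i ∩ ι(core) = ι(J k)` — then some block-additive table makes the design matrix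
`[∏_{a ∈ u i}(tx none a + Σ_{q ∈ J k} tx (some q) a)]` nonsingular. The table is EXPLICIT: base point `𝟙`, core state `q ↦ e_{ι q}`
(so a core column reads `2^{|u i ∩ ι(J k)|}`), free state of the member `{q}` ↦ `𝟙_W − 𝟙` for a suitable row set `W = u i_k` (so a free
column reads `[u i ⊆ W]`); the core columns are independent by the Gram identity on the realising rows, and the inclusion columns
`[u i ⊆ u k]` (a basis, `inclusionMatrix_isUnit`) complete them by Steinitz exchange. No genericity argument is used. -/
theorem exists_table_of_core_trace (u : Fin r → Finset (Fin h)) (hu : Function.Injective u)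
    (J : Fin r → Finset (Fin K)) (hJ : Function.Injective J) (core : Finset (Fin K)) (ι : Fin K → Fin h)
    (hι : Set.InjOn ι core)
    (hfree : ∀ k, ¬ J k ⊆ core → ∃ q, q ∉ core ∧ J k = {q})
    (hdown : ∀ k, J k ⊆ core → ∀ I ⊆ J k, ∃ k', J k' = I)
    (htrace : ∀ k, J k ⊆ core → ∃ i, u i ∩ core.image ι = (J k).image ι) :
    ∃ tx : Option (Fin K) → Fin h → ℂ,
      (Matrix.of fun i k : Fin r => ∏ a ∈ u i, (tx none a + ∑ q ∈ J k, tx (some q) a)).det ≠ 0 := by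
  classical
  -- inclusion columns `z W = ([u i ⊆ W])_i`
  set z : Finset (Fin h) → (Fin r → ℂ) := fun W i => if u i ⊆ W then 1 else 0 with hz
  have hzind : LinearIndependent ℂ (fun k : Fin r => z (u k)) := by
    have hP := Matrix.linearIndependent_cols_iff_isUnit.mpr (inclusionMatrix_isUnit u hu)
    have heq : (fun k : Fin r => z (u k)) =
        (Matrix.of fun i k : Fin r => if u i ⊆ u k then (1 : ℂ) else 0).col := by
      funext k i
      simp [hz, Matrix.col]
    rw [heq]
    exact hP
  have hzspan : Submodule.span ℂ (Set.range fun k : Fin r => z (u k)) = ⊤ := by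
    apply Submodule.eq_top_of_finrank_eq
    rw [finrank_span_eq_card hzind, Module.finrank_fintype_fun_eq_card]
  -- core columns `κ c = (2^{|u i ∩ ι(J c)|})_i`
  set κ : {k : Fin r // J k ⊆ core} → (Fin r → ℂ) := fun c i => (2 : ℂ) ^ #(u i ∩ (J c.1).image ι) with hκ
  have hκind : LinearIndependent ℂ κ := by
    rw [Fintype.linearIndependent_iff]
    intro g hg c₀
    have hJ' : Function.Injective (fun c : {k : Fin r // J k ⊆ core} => J c.1) :=
      fun c c' hcc' => Subtype.ext (hJ hcc')
    have hdown' : ∀ a : {k : Fin r // J k ⊆ core}, ∀ I ⊆ J a.1, ∃ c : {k : Fin r // J k ⊆ core}, J c.1 = I := by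
      intro a I hI
      obtain ⟨k', hk'⟩ := hdown a.1 a.2 I hI
      exact ⟨⟨k', hk'.symm ▸ hI.trans a.2⟩, hk'⟩
    have hG := isUnit_twoPowInter (fun c : {k : Fin r // J k ⊆ core} => J c.1) hJ' hdown'
    have hmul : (Matrix.of fun a b : {k : Fin r // J k ⊆ core} => (2 : ℂ) ^ #(J a.1 ∩ J b.1)).mulVec g = 0 := by
      funext a
      obtain ⟨i, hi⟩ := htrace a.1 a.2
      have hgi := congrFun hg i
      simp only [Finset.sum_apply, Pi.smul_apply, smul_eq_mul, Pi.zero_apply] at hgi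
      rw [Matrix.mulVec, dotProduct, Pi.zero_apply, ← hgi]
      refine Finset.sum_congr rfl fun b _ => ?_
      rw [Matrix.of_apply, mul_comm]
      congr 2
      have hsub : (J b.1).image ι ⊆ core.image ι := Finset.image_subset_image b.2
      have h1 : u i ∩ (J b.1).image ι = (J a.1).image ι ∩ (J b.1).image ι := by
        rw [← hi]
        ext x
        simp only [Finset.mem_inter]
        constructor
        · rintro ⟨hx1, hx2⟩; exact ⟨⟨hx1, hsub hx2⟩, hx2⟩
        · rintro ⟨⟨hx1, _⟩, hx2⟩; exact ⟨hx1, hx2⟩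
      have h2 : (J a.1).image ι ∩ (J b.1).image ι = (J a.1 ∩ J b.1).image ι :=
        (Finset.image_inter_of_injOn _ _ (hι.mono (by
          intro x hx
          simp only [Set.mem_union, Finset.mem_coe] at hx
          rcases hx with hx | hx
          · exact Finset.mem_coe.mpr (a.2 hx)
          · exact Finset.mem_coe.mpr (b.2 hx)))).symm
      rw [h1, h2, Finset.card_image_of_injOn (hι.mono fun x hx => a.2 (Finset.mem_of_mem_inter_left hx))]
    have hg0 : g = 0 := (Matrix.mulVec_injective_iff_isUnit.mpr hG) (by rw [hmul, Matrix.mulVec_zero])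
    exact congrFun hg0 c₀
  -- Steinitz exchange: complete the core columns by inclusion columns
  set S₀ : Finset (Fin r → ℂ) := Finset.univ.image κ with hS₀
  have hS₀card : #S₀ = Fintype.card {k : Fin r // J k ⊆ core} := by
    rw [hS₀, Finset.card_image_of_injective _ hκind.injective, Finset.card_univ]
  have hS₀ind : LinearIndepOn ℂ id (S₀ : Set (Fin r → ℂ)) := by
    have := hκind.linearIndepOn_id
    simpa [hS₀] using this
  have hext : ∀ n, n + Fintype.card {k : Fin r // J k ⊆ core} ≤ r → ∃ S₁ : Finset (Fin r → ℂ),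
      S₁ ⊆ Finset.univ.image (fun k => z (u k)) ∧ #S₁ = n ∧ Disjoint S₀ S₁ ∧
      LinearIndepOn ℂ id ((S₀ ∪ S₁ : Finset (Fin r → ℂ)) : Set (Fin r → ℂ)) := by
    intro n
    induction n with
    | zero =>
      intro _
      exact ⟨∅, by simp, by simp, by simp, by simpa using hS₀ind⟩
    | succ n ih =>
      intro hn
      obtain ⟨S₁, hsub, hcard, hdisj, hind⟩ := ih (by omega)
      have hlt : #(S₀ ∪ S₁) < r := by
        rw [Finset.card_union_of_disjoint hdisj, hS₀card, hcard]; omega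
      have hspan : Submodule.span ℂ ((S₀ ∪ S₁ : Finset (Fin r → ℂ)) : Set (Fin r → ℂ)) ≠ ⊤ := by
        intro htop
        have h1 := finrank_span_finset_eq_card hind
        rw [htop, finrank_top, Module.finrank_fintype_fun_eq_card, Fintype.card_fin] at h1
        omega
      have hex : ∃ i : Fin r, z (u i) ∉ Submodule.span ℂ ((S₀ ∪ S₁ : Finset (Fin r → ℂ)) : Set (Fin r → ℂ)) := by
        by_contra hall
        push Not at hall
        apply hspan
        rw [eq_top_iff, ← hzspan, Submodule.span_le]
        rintro _ ⟨i, rfl⟩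
        exact hall i
      obtain ⟨i, hi⟩ := hex
      have hnotin : z (u i) ∉ S₀ ∪ S₁ := fun hmem =>
        hi (Submodule.subset_span (Finset.mem_coe.mpr hmem))
      refine ⟨insert (z (u i)) S₁, ?_, ?_, ?_, ?_⟩
      · exact Finset.insert_subset (Finset.mem_image.mpr ⟨i, Finset.mem_univ _, rfl⟩) hsub
      · rw [Finset.card_insert_of_notMem (fun hm => hnotin (Finset.mem_union_right _ hm)), hcard]
      · rw [Finset.disjoint_insert_right]
        exact ⟨fun hm => hnotin (Finset.mem_union_left _ hm), hdisj⟩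
      · have hset : ((S₀ ∪ insert (z (u i)) S₁ : Finset (Fin r → ℂ)) : Set (Fin r → ℂ)) =
            insert (z (u i)) ((S₀ ∪ S₁ : Finset (Fin r → ℂ)) : Set (Fin r → ℂ)) := by
          push_cast
          rw [Set.union_insert]
        rw [hset]
        exact hind.id_insert hi
  have hcardC : Fintype.card {k : Fin r // J k ⊆ core} ≤ r := by
    simpa using Fintype.card_subtype_le (fun k : Fin r => J k ⊆ core)
  obtain ⟨S₁, hsub, hcard, hdisj, hind⟩ := hext (r - Fintype.card {k : Fin r // J k ⊆ core}) (by omega)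
  -- the free members, in bijection with `S₁`
  have hcardF : Fintype.card {k : Fin r // ¬ J k ⊆ core} = Fintype.card {x // x ∈ S₁} := by
    rw [Fintype.card_subtype_compl, Fintype.card_fin, Fintype.card_coe, hcard]
  set e₁ : {k : Fin r // ¬ J k ⊆ core} ≃ {x // x ∈ S₁} := Fintype.equivOfCardEq hcardF with he₁
  have hmemS : ∀ f : {k : Fin r // ¬ J k ⊆ core}, ∃ i : Fin r, z (u i) = (e₁ f).1 := by
    intro f
    have := hsub (e₁ f).2
    simpa only [Finset.mem_image, Finset.mem_univ, true_and] using this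
  choose row hrow using hmemS
  have hfq : ∀ f : {k : Fin r // ¬ J k ⊆ core}, ∃ q, q ∉ core ∧ J f.1 = {q} := fun f => hfree f.1 f.2
  choose fq hfq_notin hfq_eq using hfq
  have hfq_inj : Function.Injective fq := by
    intro f f' hff'
    apply Subtype.ext
    apply hJ
    rw [hfq_eq f, hfq_eq f', hff']
  -- THE TABLE
  let tx : Option (Fin K) → Fin h → ℂ := fun o a => o.elim 1 (fun q =>
    if q ∈ core then (if ι q = a then 1 else 0)
    else (if hq : ∃ f : {k : Fin r // ¬ J k ⊆ core}, fq f = q then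
      (if a ∈ u (row hq.choose) then 1 else 0) - 1 else 0))
  refine ⟨tx, ?_⟩
  -- the columns of the design matrix
  set col : Fin r → (Fin r → ℂ) := fun k => if hk : J k ⊆ core then κ ⟨k, hk⟩ else (e₁ ⟨k, hk⟩).1 with hcol
  have hentry_core : ∀ i k, ∀ hk : J k ⊆ core,
      ∏ a ∈ u i, (tx none a + ∑ q ∈ J k, tx (some q) a) = (2 : ℂ) ^ #(u i ∩ (J k).image ι) := by
    intro i k hk
    have hsum : ∀ a, ∑ q ∈ J k, tx (some q) a = if a ∈ (J k).image ι then 1 else 0 := by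
      intro a
      have : ∀ q ∈ J k, tx (some q) a = if ι q = a then 1 else 0 := by
        intro q hq
        simp only [tx, Option.elim, if_pos (hk hq)]
      rw [Finset.sum_congr rfl this, Finset.sum_boole]
      by_cases ha : a ∈ (J k).image ι
      · rw [if_pos ha]
        obtain ⟨q₀, hq₀, rfl⟩ := Finset.mem_image.mp ha
        have : (J k).filter (fun q => ι q = ι q₀) = {q₀} := by
          ext q
          simp only [Finset.mem_filter, Finset.mem_singleton]
          constructor
          · rintro ⟨hq, hqq⟩; exact hι (hk hq) (hk hq₀) hqq
          · rintro rfl; exact ⟨hq₀, rfl⟩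
        rw [this, Finset.card_singleton]; simp
      · rw [if_neg ha]
        have : (J k).filter (fun q => ι q = a) = ∅ := by
          rw [Finset.filter_eq_empty_iff]
          intro q hq hqa
          exact ha (Finset.mem_image.mpr ⟨q, hq, hqa⟩)
        rw [this]; simp
    simp_rw [hsum]
    have : ∀ a, (tx none a + if a ∈ (J k).image ι then (1 : ℂ) else 0) = if a ∈ (J k).image ι then 2 else 1 := by
      intro a; simp only [tx, Option.elim]; split_ifs <;> norm_num
    simp_rw [this]
    rw [Finset.prod_ite, Finset.prod_const, Finset.prod_const_one, mul_one, Finset.filter_mem_eq_inter]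
  have hentry_free : ∀ i k, ∀ hk : ¬ J k ⊆ core,
      ∏ a ∈ u i, (tx none a + ∑ q ∈ J k, tx (some q) a) = (e₁ ⟨k, hk⟩).1 i := by
    intro i k hk
    rw [← hrow ⟨k, hk⟩]
    have hJk := hfq_eq ⟨k, hk⟩
    have hex : ∃ f : {k : Fin r // ¬ J k ⊆ core}, fq f = fq ⟨k, hk⟩ := ⟨⟨k, hk⟩, rfl⟩
    have hchoose : hex.choose = ⟨k, hk⟩ := hfq_inj hex.choose_spec
    have : ∀ a, tx none a + ∑ q ∈ J k, tx (some q) a = if a ∈ u (row ⟨k, hk⟩) then 1 else 0 := by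
      intro a
      rw [hJk, Finset.sum_singleton]
      simp only [tx, Option.elim, if_neg (hfq_notin ⟨k, hk⟩), dif_pos hex, hchoose]
      ring
    simp_rw [this]
    rw [Finset.prod_boole]
    simp only [hz]
    congr 1
  have hM : (Matrix.of fun i k : Fin r => ∏ a ∈ u i, (tx none a + ∑ q ∈ J k, tx (some q) a)) =
      Matrix.of fun i k : Fin r => col k i := by
    ext i k
    simp only [Matrix.of_apply, hcol]
    by_cases hk : J k ⊆ core
    · rw [dif_pos hk, hentry_core i k hk]
    · rw [dif_neg hk, hentry_free i k hk]
  -- the columns enumerate an independent set injectively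
  have hmem_col : ∀ k, col k ∈ ((S₀ ∪ S₁ : Finset (Fin r → ℂ)) : Set (Fin r → ℂ)) := by
    intro k
    simp only [hcol, Finset.coe_union, Set.mem_union, Finset.mem_coe]
    by_cases hk : J k ⊆ core
    · left; rw [dif_pos hk, hS₀]; exact Finset.mem_image.mpr ⟨⟨k, hk⟩, Finset.mem_univ _, rfl⟩
    · right; rw [dif_neg hk]; exact (e₁ ⟨k, hk⟩).2
  have hcol_inj : Function.Injective col := by
    intro k k' hkk'
    simp only [hcol] at hkk'
    by_cases hk : J k ⊆ core <;> by_cases hk' : J k' ⊆ core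
    · rw [dif_pos hk, dif_pos hk'] at hkk'
      exact congrArg Subtype.val (hκind.injective hkk')
    · rw [dif_pos hk, dif_neg hk'] at hkk'
      exfalso
      have h0 : κ ⟨k, hk⟩ ∈ S₀ := by rw [hS₀]; exact Finset.mem_image.mpr ⟨⟨k, hk⟩, Finset.mem_univ _, rfl⟩
      exact Finset.disjoint_left.mp hdisj h0 (hkk' ▸ (e₁ ⟨k', hk'⟩).2)
    · rw [dif_neg hk, dif_pos hk'] at hkk'
      exfalso
      have h0 : κ ⟨k', hk'⟩ ∈ S₀ := by rw [hS₀]; exact Finset.mem_image.mpr ⟨⟨k', hk'⟩, Finset.mem_univ _, rfl⟩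
      exact Finset.disjoint_left.mp hdisj h0 (hkk' ▸ (e₁ ⟨k, hk⟩).2)
    · rw [dif_neg hk, dif_neg hk'] at hkk'
      exact congrArg Subtype.val (e₁.injective (Subtype.ext hkk'))
  have hcolind : LinearIndependent ℂ col := by
    let g : Fin r → ((S₀ ∪ S₁ : Finset (Fin r → ℂ)) : Set (Fin r → ℂ)) := fun k => ⟨col k, hmem_col k⟩
    have hg : Function.Injective g := fun k k' hkk' => hcol_inj (congrArg Subtype.val hkk')
    have := hind.comp g hg
    exact this
  rw [hM]
  have hunit : IsUnit (Matrix.of fun i k : Fin r => col k i) := by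
    rw [← Matrix.linearIndependent_cols_iff_isUnit]
    exact hcolind
  obtain ⟨v, hv⟩ := hunit
  rw [← hv]
  exact (Matrix.isUnit_iff_isUnit_det _ |>.mp v.isUnit).ne_zero

/-! ## 4. Shattered sets from size: the Sauer–Shelah–Perles lemma (Mathlib) -/

/-- **A family of more than `Σ_{i<m} C(h,i)` distinct subsets of `Fin h` shatters some `m`-set.** -/
theorem exists_shatters_of_card_gt (u : Fin r → Finset (Fin h)) (hu : Function.Injective u) (m : ℕ)
    (hr : ∑ i ∈ Finset.range m, h.choose i < r) :
    ∃ A : Finset (Fin h), #A = m ∧ (Finset.univ.image u).Shatters A := by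
  classical
  set 𝒜 := Finset.univ.image u with h𝒜
  have hcard : #𝒜 = r := by
    rw [h𝒜, Finset.card_image_of_injective _ hu, Finset.card_univ, Fintype.card_fin]
  have hvc : m ≤ 𝒜.vcDim := by
    by_contra hlt
    push Not at hlt
    have h1 := Finset.card_le_card_shatterer 𝒜
    have h2 := Finset.card_shatterer_le_sum_vcDim (𝒜 := 𝒜)
    rw [Fintype.card_fin] at h2
    have h3 : ∑ k ∈ Finset.Iic 𝒜.vcDim, h.choose k ≤ ∑ i ∈ Finset.range m, h.choose i := by
      apply Finset.sum_le_sum_of_subset_of_nonneg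
      · intro k hk
        rw [Finset.mem_Iic] at hk
        rw [Finset.mem_range]
        omega
      · intros; exact Nat.zero_le _
    omega
  have hne : 𝒜.shatterer.Nonempty := by
    refine ⟨∅, Finset.mem_shatterer.mpr (Finset.shatters_empty.mpr ?_)⟩
    rw [← Finset.card_pos, hcard]
    omega
  obtain ⟨s, hs, hsup⟩ := Finset.exists_mem_eq_sup 𝒜.shatterer hne Finset.card
  have hscard : m ≤ #s := by rw [← hsup]; exact hvc
  obtain ⟨A, hAs, hA⟩ := Finset.exists_subset_card_eq hscard
  exact ⟨A, hA, (Finset.mem_shatterer.mp hs).mono_right hAs⟩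

end FullJoin

end

end Summit.ValiantsHypothesis.ValiantsHypothesis.Theorems.BarrierLever.HiddenStates
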